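import Literature.Analysis.FunctionSpaces.TorusInverseLaplacianCalculus
import HarnessLib

/-!
# First-order Taylor expansion in time of jointly smooth fields on `S × T^d`, uniformly in space

Analysis/FunctionSpaces proof file (theorems only; no definitions, no named facts), complementing
`TorusCalculusProofs` (`Torus.IsSmoothSpaceTimeOn.hasDerivWithinAt_slice`: the slices `s ↦ φ s x`
are differentiable within the time set, pointwise in `x`;
`….eventually_norm_timeDerivWithin_sub_lt`: `∂ₜφ(s, ·) → ∂ₜφ(t, ·)` uniformly on `T^d` as `s → t`
within the time set) and `TorusSpaceTime` (`….eventually_norm_sub_lt`, the tube lemma). For `φ`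
jointly smooth on `S × T^d` (`Torus.IsSmoothSpaceTimeOn S φ`), `S ⊆ ℝ` convex and `t ∈ S`:

* `Torus.IsSmoothSpaceTimeOn.eventually_norm_sub_sub_smul_le` — the **uniform Taylor remainder**:
  for every `ε > 0`, for `s` near `t` within `S` and every `x ∈ T^d`,
  `‖φ s x − φ t x − (s − t) • ∂ₜφ t x‖ ≤ ε |s − t|`
  (the mean value inequality on the time segment between `t` and `s`, which lies in `S`, applied
  to `τ ↦ φ τ x − τ • ∂ₜφ t x`, whose one-sided derivative `∂ₜφ τ x − ∂ₜφ t x` is uniformly small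
  for `τ` near `t` by the tube lemma over the compact torus; if `t` is isolated in `S` the
  statement is empty);
* `Torus.IsSmoothSpaceTimeOn.eventually_integral_norm_sub_sub_smul_sq_le` — its `L²(T^d)` form
  `∫ ‖φ s − φ t − (s − t) • ∂ₜφ t‖² ≤ (ε |s − t|)²` (`T^d` has measure one). This is the estimate
  that makes the `L²`-class curve `s ↦ [φ s]` of a classical field differentiable within `S`,
  with derivative the class of `∂ₜφ t` — the passage from classical solutions to `H`-valued
  strong solutions `u ∈ C¹([0, T]; H)` (Constantin–Foias 1988, Ch. 5, (5.9)–(5.10);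
  Robinson–Rodrigo–Sadowski 2016, §3.1);
* `Torus.IsSmoothSpaceTimeOn.isDivFree_timeDerivWithin` — on `[a, b] × T^d`, `a < b`, the
  one-sided time derivative of a jointly smooth vector field with divergence-free slices is
  divergence free: `div ∂ₜu = ∑ᵢ (∂ᵢ∂ₜu)ᵢ = ∑ᵢ (∂ₜ∂ᵢu)ᵢ = ∂ₜ div u = 0` (`∂ₜ∂ᵢ = ∂ᵢ∂ₜ`,
  `Torus.timeDerivWithin_partialDeriv_comm`). Together with
  `Torus.IsSmoothSpaceTimeOn.hasZeroMean_timeDerivWithin` (`TorusClassicalNSTimeDerivLinearised`)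
  this makes `∂ₜu(t)` a smooth divergence-free mean-zero field whenever the slices `u(t)` are, so
  that the derivative of the state curve is again an honest state of the energy space.

## Mathlib / tree search

Tree (reused): `Torus.IsSmoothSpaceTimeOn.hasDerivWithinAt_slice`,
`….eventually_norm_timeDerivWithin_sub_lt`, `….isSmooth_timeDerivWithin`,
`Torus.interior_nonempty_of_convex_of_accPt` (`TorusCalculusProofs`), `….partialDeriv`, `….apply`
(`TorusSpaceTime`), `Torus.timeDerivWithin_partialDeriv_comm`, `Torus.timeDerivWithin_clm_comp`,
`Torus.timeDerivWithin_finset_sum` (`TorusInverseLaplacianCalculus`),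
`Torus.divergence_eq_sum_partialDeriv_apply` (`TorusEnstrophyOrthogonality`). The special case of
`isDivFree_timeDerivWithin` for classical Navier–Stokes solutions is
`Torus.IsClassicalNSSolutionOn.isDivFree_timeDerivWithin` (`TorusClassicalNSTimeDerivative`), whose
proof is followed here with the solution hypothesis replaced by divergence-free slices. Searched
`sub_sub_smul.*timeDerivWithin`, `• timeDerivWithin`, `Taylor.*stLift`: no uniform-in-space Taylor
remainder in the tree; `L2ValuedPathDeriv.hasDerivAt_toLp` is the two-sided (`HasDerivAt` on all
of `ℝ`) `L²`-valued statement from pointwise derivatives, not applicable within a time interval.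
Mathlib: `Convex.norm_image_sub_le_of_norm_hasDerivWithin_le` (mean value inequality within a
convex set), `accPt_principal_iff_nhdsWithin`, `nhdsWithin_insert`.

## References

* P. Constantin, C. Foias, *Navier–Stokes Equations*, Univ. Chicago Press 1988, Ch. 5,
  (5.9)–(5.10) (the functional form `u' + νAu + B(u) = f` in `H`). [ConstantinFoiasNSE1988]
* J. C. Robinson, J. L. Rodrigo, W. Sadowski, *The Three-Dimensional Navier–Stokes Equations*,
  CUP 2016, §3.1 (from classical to weak/strong solutions). [RobinsonRodrigoSadowski2016]
* L. C. Evans, *Partial Differential Equations*, 2nd ed. (2010), §5.9.2 (calculus in spaces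
  involving time). [Evans2010]
-/

open MeasureTheory Set Filter
open scoped Topology

noncomputable section

namespace Literature.Analysis.FunctionSpaces

namespace Torus

variable {d : Type*} [Fintype d]
variable {F : Type*} [NormedAddCommGroup F] [NormedSpace ℝ F]

/-! ## The uniform first-order Taylor remainder in time -/

section Taylor

variable {S : Set ℝ} {φ : ℝ → UnitAddTorus d → F}

/-- **Uniform first-order Taylor expansion in time.** For a jointly smooth field `φ` on `S × T^d`,
`S` convex, `t ∈ S` and `ε > 0`: for `s` near `t` within `S` and every `x`,
`‖φ s x − φ t x − (s − t) • ∂ₜφ t x‖ ≤ ε |s − t|`, where `∂ₜφ = Torus.timeDerivWithin S φ` is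
the one-sided time derivative (mean value inequality along the time segment between `t` and `s`
for `τ ↦ φ τ x − τ • ∂ₜφ t x`, whose derivative `∂ₜφ τ x − ∂ₜφ t x` is uniformly small by the
tube lemma over the compact torus; Evans 2010, §5.9.2). [folklore] -/
theorem IsSmoothSpaceTimeOn.eventually_norm_sub_sub_smul_le (hφ : IsSmoothSpaceTimeOn S φ)
    (hS : Convex ℝ S) {t : ℝ} (ht : t ∈ S) {ε : ℝ} (hε : 0 < ε) :
    ∀ᶠ s in 𝓝[S] t, ∀ x,
      ‖φ s x - φ t x - (s - t) • Torus.timeDerivWithin S φ t x‖ ≤ ε * |s - t| := by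
  by_cases hacc : AccPt t (𝓟 S)
  swap
  · -- `t` is isolated in `S`: `𝓝[S] t = pure t`, and the remainder vanishes at `s = t`
    have h0 : 𝓝[S \ {t}] t = ⊥ := by rwa [accPt_principal_iff_nhdsWithin, not_neBot] at hacc
    have h1 : 𝓝[S] t = pure t := by
      rw [← insert_eq_of_mem ht, ← insert_sdiff_singleton, nhdsWithin_insert, h0, sup_bot_eq]
    rw [h1, eventually_pure]
    intro x
    simp
  have hU : UniqueDiffOn ℝ S :=
    uniqueDiffOn_convex hS (interior_nonempty_of_convex_of_accPt hS ht hacc)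
  -- uniform smallness of `∂ₜφ s − ∂ₜφ t` on a ball around `t` (within `S`)
  obtain ⟨δ, hδ, hδε⟩ : ∃ δ > 0, ∀ s ∈ S, dist s t < δ → ∀ x,
      ‖Torus.timeDerivWithin S φ s x - Torus.timeDerivWithin S φ t x‖ < ε := by
    rcases Metric.mem_nhdsWithin_iff.1 (hφ.eventually_norm_timeDerivWithin_sub_lt hU ht hε) with
      ⟨δ, hδ, h⟩
    exact ⟨δ, hδ, fun s hs hst x => h ⟨hst, hs⟩ x⟩
  have hball : ∀ᶠ s in 𝓝[S] t, dist s t < δ :=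
    (Metric.tendsto_nhds.1 tendsto_id δ hδ).filter_mono nhdsWithin_le_nhds
  filter_upwards [self_mem_nhdsWithin, hball] with s hs hsδ x
  -- the mean value inequality on the convex set `S ∩ B(t, δ)` for `τ ↦ φ τ x − τ • ∂ₜφ t x`
  have hconv : Convex ℝ (S ∩ Metric.ball t δ) := hS.inter (convex_ball t δ)
  have hder : ∀ τ ∈ S ∩ Metric.ball t δ,
      HasDerivWithinAt (fun τ => φ τ x - τ • Torus.timeDerivWithin S φ t x)
        (Torus.timeDerivWithin S φ τ x - Torus.timeDerivWithin S φ t x) (S ∩ Metric.ball t δ) τ :=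
    fun τ hτ => by
    have h := ((hφ.hasDerivWithinAt_slice hτ.1 x).sub
      ((hasDerivWithinAt_id τ S).smul_const (Torus.timeDerivWithin S φ t x))).mono
      (inter_subset_left (s := S) (t := Metric.ball t δ))
    rwa [one_smul] at h
  have hMVT := hconv.norm_image_sub_le_of_norm_hasDerivWithin_le hder
    (fun τ hτ => (hδε τ hτ.1 hτ.2 x).le) ⟨ht, Metric.mem_ball_self hδ⟩ ⟨hs, hsδ⟩
  calc ‖φ s x - φ t x - (s - t) • Torus.timeDerivWithin S φ t x‖
      = ‖φ s x - s • Torus.timeDerivWithin S φ t x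
          - (φ t x - t • Torus.timeDerivWithin S φ t x)‖ := by
        rw [sub_smul]
        congr 1
        abel
    _ ≤ ε * ‖s - t‖ := hMVT
    _ = ε * |s - t| := by rw [Real.norm_eq_abs]

/-- **The `L²` Taylor remainder in time.** For a jointly smooth field `φ` on `S × T^d`, `S` convex,
`t ∈ S` and `ε > 0`: for `s` near `t` within `S`,
`∫ ‖φ s x − φ t x − (s − t) • ∂ₜφ t x‖² dx ≤ (ε |s − t|)²` (the uniform remainder integrated over
the probability space `T^d`). Hence the `L²`-class curve `s ↦ [φ s]` is differentiable within `S`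
with derivative `[∂ₜφ t]`: classical solutions are strong `H`-valued solutions (Constantin–Foias
1988, Ch. 5, (5.9)–(5.10)). [folklore] -/
theorem IsSmoothSpaceTimeOn.eventually_integral_norm_sub_sub_smul_sq_le
    (hφ : IsSmoothSpaceTimeOn S φ) (hS : Convex ℝ S) {t : ℝ} (ht : t ∈ S) {ε : ℝ} (hε : 0 < ε) :
    ∀ᶠ s in 𝓝[S] t,
      ∫ x, ‖φ s x - φ t x - (s - t) • Torus.timeDerivWithin S φ t x‖ ^ 2 ≤ (ε * |s - t|) ^ 2 := by
  filter_upwards [hφ.eventually_norm_sub_sub_smul_le hS ht hε] with s hs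
  calc ∫ x, ‖φ s x - φ t x - (s - t) • Torus.timeDerivWithin S φ t x‖ ^ 2
      ≤ ∫ _ : UnitAddTorus d, (ε * |s - t|) ^ 2 :=
        integral_mono_of_nonneg (Eventually.of_forall fun x => sq_nonneg _) (integrable_const _)
          (Eventually.of_forall fun x => pow_le_pow_left₀ (norm_nonneg _) (hs x) 2)
    _ = (ε * |s - t|) ^ 2 := by simp

end Taylor

/-! ## The time derivative of a field with divergence-free slices is divergence free -/

section DivFree

variable [DecidableEq d]

/-- **`div ∂ₜu = 0` for jointly smooth fields with divergence-free slices** on `[a, b] × T^d`,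
`a < b`, at every `t ∈ [a, b]` (one-sided time derivative within `[a, b]`):
`div ∂ₜu = ∑ᵢ (∂ᵢ∂ₜu)ᵢ = ∑ᵢ (∂ₜ∂ᵢu)ᵢ = ∂ₜ (∑ᵢ (∂ᵢu)ᵢ) = ∂ₜ div u = 0`
(`Torus.timeDerivWithin_partialDeriv_comm`; the classical-solution case is
`Torus.IsClassicalNSSolutionOn.isDivFree_timeDerivWithin`). [folklore] -/
theorem IsSmoothSpaceTimeOn.isDivFree_timeDerivWithin {a b : ℝ} (hab : a < b)
    {u : ℝ → UnitAddTorus d → EuclideanSpace ℝ d} (hu : IsSmoothSpaceTimeOn (Icc a b) u)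
    (hdiv : ∀ s ∈ Icc a b, IsDivFree (u s)) {t : ℝ} (ht : t ∈ Icc a b) :
    IsDivFree (Torus.timeDerivWithin (Icc a b) u t) := by
  intro x
  have hS : UniqueDiffOn ℝ (Icc a b) := uniqueDiffOn_Icc hab
  have hA : IsSmooth (Torus.timeDerivWithin (Icc a b) u t) := hu.isSmooth_timeDerivWithin hS ht
  rw [divergence_eq_sum_partialDeriv_apply (hA.isContDiff (by simp))]
  -- `(∂ᵢ∂ₜu)ᵢ = ∂ₜ ((∂ᵢu)ᵢ)`
  have e1 : ∀ i, Torus.partialDeriv i (Torus.timeDerivWithin (Icc a b) u t) x i =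
      Torus.timeDerivWithin (Icc a b) (fun s y => Torus.partialDeriv i (u s) y i) t x := by
    intro i
    have hk : Torus.timeDerivWithin (Icc a b) (fun s y => Torus.partialDeriv i (u s) y i) t x =
        (Torus.timeDerivWithin (Icc a b) (fun s => Torus.partialDeriv i (u s)) t x) i :=
      timeDerivWithin_clm_comp (hu.partialDeriv hS i) hS (EuclideanSpace.proj i) ht x
    rw [hk, timeDerivWithin_partialDeriv_comm hab hu ht i x]
  simp only [e1]
  -- `∑ᵢ ∂ₜ((∂ᵢu)ᵢ) = ∂ₜ (∑ᵢ (∂ᵢu)ᵢ) = ∂ₜ (div u) = 0` on `[a, b]`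
  have hsum :
      Torus.timeDerivWithin (Icc a b) (fun s y => ∑ i, Torus.partialDeriv i (u s) y i) t x =
        ∑ i, Torus.timeDerivWithin (Icc a b) (fun s y => Torus.partialDeriv i (u s) y i) t x :=
    timeDerivWithin_finset_sum Finset.univ (U := fun i s y => Torus.partialDeriv i (u s) y i)
      (fun i _ => (hu.partialDeriv hS i).apply i) hS ht x
  rw [← hsum]
  have e2 : ∀ s ∈ Icc a b,
      (fun y => ∑ i, Torus.partialDeriv i (u s) y i) = fun _ => (0 : ℝ) := by
    intro s hs
    funext y
    rw [← divergence_eq_sum_partialDeriv_apply ((hu.isSmooth_slice hs).isContDiff (by simp))]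
    exact hdiv s hs y
  unfold Torus.timeDerivWithin
  rw [derivWithin_congr (f := fun _ => (0 : ℝ)) (fun s hs => congrFun (e2 s hs) x)
    (congrFun (e2 t ht) x)]
  simp

end DivFree

end Torus

end Literature.Analysis.FunctionSpaces

end
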